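import Summits.RiemannHypothesis.RiemannHypothesis.Theses.DensityLadder
import Literature.NumberTheory.LFunctions.MontgomeryLargeValuesConjecture
import HarnessLib

/-!
# Line `birth` — BC3 skeleton for the crux `DensityBelowBourgain` (stmt-RiemannHypothesis-19601)

Route `DensityLadder` (route-RiemannHypothesis-DensityLadder), crux (rank 3)
`Summit.RiemannHypothesis.RiemannHypothesis.Theses.DensityLadder.DensityBelowBourgain`:
**the Density Hypothesis from an abscissa strictly left of Bourgain's** —
`∃ σ₀ < 25/32, ZeroDensityEstimate (fun _ ↦ 2) σ₀`, i.e. `N(σ, T) ≪_ε T^{2(1−σ)+ε}` for every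
`σ₀ ≤ σ ≤ 1` (`N(σ, T) = Literature.NumberTheory.LFunctions.zetaZeroCountRe σ T`).

## THE LINE = "τ₀ = 3/2 zero detection" (Tao–Trudgian–Yang, arXiv:2501.16779, §6, Cor. 43 and the
proof of Thm. 45, pp. 17–18 of the held text, read: "Apply Corollary 43 with `τ₀ = 3/2` (so that
(lvoz) is vacuously true)")

TTY Corollary 43 with `τ₀ = 3/2`: for `1/2 < σ < 1`, the zero-density bound `A(σ) ≤ 3/τ₀ = 2`
(the Density Hypothesis AT `σ`) follows from the large-values bound
`LV(σ, τ) ≤ (3 − 3σ) τ/τ₀ = 2τ(1 − σ)` for `2τ₀/3 = 1 ≤ τ ≤ τ₀ = 3/2` ALONE — the `ζ`-sum condition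
`LV_ζ(σ, τ) ≤ …` for `2 ≤ τ < 4τ₀/3 = 2` is vacuous. In words: a `1`-separated set of points of
`[0, T]` at which a `1`-bounded Dirichlet polynomial of length `N`, `T^{2/3} ≤ N ≤ T`, takes values
`≥ N^{σ−o(1)}` has `≤ T^{2(1−σ)+o(1)}` elements ("DH-strength large values", the local predicate
`LargeValuesDHStrength σ` below, finitary and uniform in `N ∈ [T^{2/3}, T]`). Montgomery's
conjecture (TTY Conj. 30, `LV(σ,τ) ≤ 2 − 2σ`; tree: `MontgomeryLargeValueConjecture` in the
Guth–Maynard Conj. 1.5 form) implies it (`2 − 2σ ≤ 2τ(1−σ)` for `τ ≥ 1`); the mean value theorem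
(TTY Thm. 31: `max(2−2σ, 1+τ−2σ)`) does NOT (at `τ = 3/2`: `5/2 − 2σ > 3 − 3σ` iff `σ > 1/2`), nor does
Guth–Maynard's Thm. 1.1 (`τ + 12/5 − 4σ > 3 − 3σ` iff `σ < 9/10` at `τ = 3/2`); Bourgain's 2000 family
gives it exactly down to `σ = 25/32` (TTY Thm. 51: binding term `9/(8(2σ−1)) = 2 ⟺ σ = 25/32`), which
is why the tree's literature floor is `ZeroDensityEstimate (fun _ ↦ 2) (25/32)` and the crux asks for
`σ₀ < 25/32`.

* **Stub LV** `stub_largeValues_DHstrength_belowBourgain` (the INPUT; open; XL): there is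
  `1/2 < σ₁ < 25/32` such that `LargeValuesDHStrength σ` holds for every `σ₁ ≤ σ ≤ 25/32` — a new
  large-values inequality at `τ = 3/2` strictly left of Bourgain's abscissa (the crux's own "why it
  might fail": every tabulated large-values input is slack there; the GM-type energy input is proved
  only for `N ≥ T^{3/4}`, not at `N = T^{2/3}`).
* **Stub DETECT** `stub_zeroDetection_threeHalves` (the zero-detection THEOREM of the line; in print,
  TTY Cor. 43 at `τ₀ = 3/2`; L–XL to formalise over the tree's apparatus): for `1/2 < σ < 1`,
  `LargeValuesDHStrength σ` implies `N(σ, T) = O_ε(T^{2(1−σ)+ε})` for every `ε > 0`. Proof route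
  (TTY Lemma 39 + Lemma 33 + Cor. 41–43, in the tree's normalisation of
  `ZeroDensityGuthMaynardWindow.lean`): zero detection `HuxleyZeroDensity.zeroDetection_integral`
  (`X = T^η`, `Y = T^{1/2}`); class (ii) by the fourth moment on disjoint windows
  (`HuxleyIvic.classTwo_fourth_le`, `zetaFourthMomentWeak`): `≪ T^{2−2σ+O(η)}` — already DH-strength
  at every `σ`; class (i): a block `(M, 2M]`, `T^η ≤ M ≤ T^{1/2+η/2}`, raised to the power `k` with
  `M^k ∈ [T^{2/3}, T]` (`k = 2` for `M ≥ T^{1/3}`; for `M = T^μ`, `μ ≤ 1/3`, the interval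
  `[2/(3μ), 1/μ]` has length `≥ 1`), coefficients `≪ T^{O(η)}` (`HuxleyIvic.norm_powCoeff_le`),
  real parts removed by `GuthMaynardWindow.taylor_pigeonhole`, coefficients renormalised to `≤ 1`
  (`GuthMaynardWindow.realPoints_count_LV`), large value `≥ P^{σ} T^{−O(η)} ≥ P^{σ−δ}` once
  `η ≪ δ` (`P ≥ T^{2/3}`); `LargeValuesDHStrength σ` counts each class by `C T^{2(1−σ)+ε}`; blocks
  overshooting `T` by `T^{O(η)}` go to the discrete mean value theorem
  (`GuthMaynardWindow.realPoints_count_MVT`: `(P + T)P^{1−2σ} ≲ T^{(2−2σ)(1+O(η))}`); then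
  thinning (`HuxleyZeroDensity.card_le_of_thinning`) and the counting layer
  `ZeroDensity.wellSpacedBound_of_eventually` / `count_dyadic_le` / `isBigO_of_dyadic`.
* **Stub FLOOR** `stub_bourgain_floor` (the literature floor; a published theorem not yet vendored;
  M as a Literature named fact + bridge): `ZeroDensityEstimate (fun _ ↦ 2) (25/32)` — the Density
  Hypothesis on `[25/32, 1]` (Bourgain, IMRN 2000, for `σ > 25/32`; the endpoint by TTY Thm. 51,
  `A(σ) ≤ max(2/(9σ−6), 9/(8(2σ−1))) = 2` at `σ = 25/32`; on `[5/6, 1]` it is the tree's PROVED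
  `zeroDensityEstimate_two_five_sixths_of_ivic_huxley Ivic1985_theorem11_1_huxley_holds`). The route
  header files it as the wanted named fact `zeroDensity_bourgain` next to `zeroDensity_huxley`.
* **Composition** `DensityBelowBourgain_of (hLV) (hDet) (hFloor) : DensityLadder.DensityBelowBourgain`
  (sorry-free, the crux BY NAME): take `σ₀ := σ₁` from LV; for `σ₁ ≤ σ ≤ 25/32` DETECT (fed with LV
  at `σ`, `1/2 < σ₁ ≤ σ ≤ 25/32 < 1`) gives the `T^{2(1−σ)+ε}` bound, which is the `σ`-instance of
  `ZeroDensityEstimate (fun _ ↦ 2) σ₁`; for `25/32 ≤ σ ≤ 1` FLOOR gives it. The seam is the honest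
  case split of the ladder (window below Bourgain's abscissa / literature floor above it).

Why the cut is not shredding/costume: LV is a statement about exponential sums with NO zeta zeros
in it (RH-incomparable, open only on the window `[σ₁, 25/32)`); DETECT is an implication whose extra
hypothesis is open; FLOOR is DH on `[25/32, 1]`, which gives no abscissa `< 25/32`. No stub gives the
crux or the summit on its own (BC3 probes, planner folder `bc/`, log at the end of this file), and
`LV → crux` genuinely needs DETECT + FLOOR (two theorems not in the tree).

Disproof used: none on file (`ledger crux ls stmt-RiemannHypothesis-19601`: no workfiles, no
`Disproof.lean`, 2026-08-17) — no `_false_without_` obligation to honour. Negatives index consulted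
(`ledger negatives --problem RiemannHypothesis`, 2026-08-17: two entries — a Jacobi-symbol sine-series
positivity and a de Bruijn–Laplace `HasOnlyRealZeros` statement — unrelated; no stub is an instance).
Landed negative nearby: `Literature.NumberTheory.LFunctions.montgomeryLargeValuesConjecture_false`
(the `ℓ²` form of Montgomery's conjecture with ARBITRARY coefficients and no regime) — LV is NOT an
instance: sup-normalised coefficients (`‖b n‖ ≤ 1`), the polynomial regime `T^{2/3} ≤ N ≤ T`, and a
count `T^{2(1−σ)+ε}` that Montgomery's conjecture in the vetted Guth–Maynard form implies
(`largeValuesDHStrength_of_LVC` below, sorry-free calibration).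

Sources: TaoTrudgianYang2025 = arXiv:2501.16779 §5 Def. 25/27, Lemma 29, Conj. 30, Thm. 31, Thm. 32,
Lemma 33; §6 Def. 37, Lemma 39, Cor. 41–43, Thm. 45, Thm. 48, Thm. 51 (pp. 12–19 of the held text);
Bourgain2000 (IMRN 2000 no. 3, 133–146); GuthMaynard2024 = arXiv:2405.20552 Thm. 1.1, Conj. 1.5, §13.1;
Ivic1985 ch. 11; the tree files `ZeroDensityGuthMaynardWindow.lean`, `DensityHypothesisStatus.lean`,
`ZeroCounting.lean`.
-/

set_option linter.dupNamespace false
set_option linter.unusedVariables false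

noncomputable section

namespace Summit.RiemannHypothesis.RiemannHypothesis.Cruxes.DensityBelowBourgain.Birth

open Complex Finset Filter Asymptotics
open Literature.NumberTheory.LFunctions
open Summit.RiemannHypothesis.RiemannHypothesis.Theses.DensityLadder

/-! ## The large-values predicate of the line -/

/-- **DH-strength large values at `σ` on `T^{2/3} ≤ N ≤ T`** (TTY: `LV(σ, τ) ≤ 2τ(1 − σ)` for
`1 ≤ τ ≤ 3/2`, Def. 27 in its non-asymptotic form, made uniform over the compact `τ`-range): for
every `ε > 0` there are `δ > 0`, `C`, `T₀` such that for `T ≥ T₀`, every `N` with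
`T^{2/3} ≤ N ≤ T`, every `1`-bounded `b`, and every finite `1`-separated `W ⊂ [0, T]` on which
`|∑_{N ≤ n ≤ 2N} b_n n^{it}| ≥ N^{σ−δ}`, one has `#W ≤ C T^{2(1−σ)+ε}`. (Same rendering of large-value
patterns as the hypothesis `hLV` of `isBigO_zetaZeroCountRe_window_of_largeValues`,
`ZeroDensityGuthMaynardWindow.lean`.) Trivial for `σ ≤ 1/2` (`#W ≤ T + 1`); implied by
Montgomery's conjecture for every `σ > 1/2` (`largeValuesDHStrength_of_LVC`); known from Bourgain
2000 for `σ ≥ 25/32`; OPEN below. [cite: TaoTrudgianYang2025, Definition 27 and Corollary 43] -/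
def LargeValuesDHStrength (σ : ℝ) : Prop :=
  ∀ ε : ℝ, 0 < ε → ∃ δ C T₀ : ℝ, 0 < δ ∧ ∀ T : ℝ, T₀ ≤ T →
    ∀ (N : ℕ) (b : ℕ → ℂ) (W : Finset ℝ), T ^ (2 / 3 : ℝ) ≤ (N : ℝ) → (N : ℝ) ≤ T →
    (∀ n, ‖b n‖ ≤ 1) → (∀ t ∈ W, 0 ≤ t ∧ t ≤ T) →
    (∀ t ∈ W, ∀ t' ∈ W, t ≠ t' → 1 ≤ |t - t'|) →
    (∀ t ∈ W, (N : ℝ) ^ (σ - δ) ≤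
      ‖∑ n ∈ Finset.Icc N (2 * N), b n * (n : ℂ) ^ ((t : ℂ) * I)‖) →
    (W.card : ℝ) ≤ C * T ^ (2 * (1 - σ) + ε)

/-! ## The three registered stubs -/

/-- **Stub LV — DH-STRENGTH LARGE VALUES STRICTLY LEFT OF BOURGAIN'S ABSCISSA** (the line's INPUT;
open; XL). There is `σ₁` with `1/2 < σ₁ < 25/32` such that `LargeValuesDHStrength σ` holds for every
`σ₁ ≤ σ ≤ 25/32`: a new large-values inequality `LV(σ, τ) ≤ 2τ(1−σ)`, `1 ≤ τ ≤ 3/2`, on a window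
below `25/32`. Why plausibly true: Montgomery's conjecture gives it for all `σ > 1/2`
(`largeValuesDHStrength_of_LVC`), and at `σ = 25/32` it is Bourgain's theorem (TTY Thm. 32/51).
Why it might fail (as a target, not as a truth): below `25/32` every tabulated large-values bound is
slack at `τ = 3/2` (TTY Thm. 51 improves `A(σ)` on `[17/22, 25/32)` but not the DH threshold, where
`9/(8(2σ−1)) = 2`), and Guth–Maynard-type energy input is proved only for `N ≥ T^{3/4}`; a
genuinely new inequality at `(σ, τ) = (25/32 − η, 3/2)` is required.
[cite: TaoTrudgianYang2025, Theorem 32, Theorem 51 and Corollary 43] [cite: Bourgain2000] -/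
theorem stub_largeValues_DHstrength_belowBourgain :
    ∃ σ₁ : ℝ, 1 / 2 < σ₁ ∧ σ₁ < 25 / 32 ∧ ∀ σ : ℝ, σ₁ ≤ σ → σ ≤ 25 / 32 → LargeValuesDHStrength σ := by
  sorry

/-- **Stub DETECT — ZERO DETECTION AT `τ₀ = 3/2`** (the line's theorem; in print: TTY Cor. 43 with
`τ₀ = 3/2`, the `ζ`-sum condition being vacuous; L–XL to formalise). For `1/2 < σ < 1`, DH-strength
large values at `σ` on `T^{2/3} ≤ N ≤ T` imply the Density Hypothesis at `σ`:
`N(σ, T) = O_ε(T^{2(1−σ)+ε})` for every `ε > 0`. Proof route (module docstring): the tree's zero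
detection `HuxleyZeroDensity.zeroDetection_integral`; class (ii) by the fourth moment
(`≪ T^{2−2σ+O(η)}`); class (i) blocks raised to a power `k` with `M^k ∈ [T^{2/3}, T]`, real parts
removed (`GuthMaynardWindow.taylor_pigeonhole`), counted by `LargeValuesDHStrength σ` (or by the
discrete mean value theorem for blocks just above `T`), then thinning and the counting layer of
`ZeroDensityInghamTools`. Why it might fail: only as a formalisation target (the power bookkeeping
for `M ≤ T^{1/3}` and the `T^{O(η)}` losses against the `δ`-window of the hypothesis); the
mathematics is TTY Lemma 39 + Lemma 33 + Cor. 41–43.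
[cite: TaoTrudgianYang2025, Lemma 39, Lemma 33, Corollaries 41-43, Theorem 45] -/
theorem stub_zeroDetection_threeHalves :
    ∀ σ : ℝ, 1 / 2 < σ → σ < 1 → LargeValuesDHStrength σ → ∀ ε > 0, (fun T : ℝ ↦ (zetaZeroCountRe σ T : ℝ)) =O[atTop] fun T : ℝ ↦ T ^ (2 * (1 - σ) + ε) := by
  sorry

/-- **Stub FLOOR — BOURGAIN'S DENSITY THEOREM** (literature floor; a published theorem, to be
vendored as the named fact `zeroDensity_bourgain` next to `zeroDensity_huxley` in
`ZeroCounting.lean` and bridged here; M). The Density Hypothesis holds on `[25/32, 1]`: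
`N(σ, T) ≪_ε T^{2(1−σ)+ε}` for `25/32 ≤ σ ≤ 1` (Bourgain, IMRN 2000, for `σ > 25/32`; the
endpoint from TTY Thm. 51, `A(σ) ≤ max(2/(9σ−6), 9/(8(2σ−1)))` on `[17/22, 4/5]`, `= 2` at
`σ = 25/32`; on `[5/6, 1]` already the tree's
`zeroDensityEstimate_two_five_sixths_of_ivic_huxley Ivic1985_theorem11_1_huxley_holds`). Why it
might fail: not mathematically (in print); only the vendoring is owed.
[cite: Bourgain2000] [cite: TaoTrudgianYang2025, Theorem 51 and the remark preceding it] -/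
theorem stub_bourgain_floor :
    ZeroDensityEstimate (fun _ ↦ 2) (25 / 32) := by
  sorry

/-! ## Stub statements by name

The skeleton gate reads the composition's hypotheses BY NAME: each must be a declared stub. The
`abbrev`s below are the stubs' exact elaborated types (`type_of%`), so `DensityBelowBourgain_of`
takes `(h : Statement.stub_<name>)` and nothing else. -/

namespace Statement

/-- Statement of `stub_largeValues_DHstrength_belowBourgain` (LV). -/
abbrev stub_largeValues_DHstrength_belowBourgain : Prop :=
  type_of% @Birth.stub_largeValues_DHstrength_belowBourgain
/-- Statement of `stub_zeroDetection_threeHalves` (DETECT). -/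
abbrev stub_zeroDetection_threeHalves : Prop := type_of% @Birth.stub_zeroDetection_threeHalves
/-- Statement of `stub_bourgain_floor` (FLOOR). -/
abbrev stub_bourgain_floor : Prop := type_of% @Birth.stub_bourgain_floor

end Statement

/-! ## The crux from the stubs (kernel-checked composition, no `sorry`) -/

/-- **THE SKELETON THEOREM — the crux BY NAME from the three stub statements** (LV → DETECT →
FLOOR → `DensityLadder.DensityBelowBourgain`). With `σ₁` from LV as the abscissa: on
`[σ₁, 25/32]` DETECT fed with LV at `σ` (`1/2 < σ₁ ≤ σ ≤ 25/32 < 1`) gives the `σ`-instance of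
`ZeroDensityEstimate (fun _ ↦ 2) σ₁`; on `[25/32, 1]` FLOOR gives it. [folklore] -/
theorem DensityBelowBourgain_of (hLV : Statement.stub_largeValues_DHstrength_belowBourgain)
    (hDet : Statement.stub_zeroDetection_threeHalves) (hFloor : Statement.stub_bourgain_floor) :
    Summit.RiemannHypothesis.RiemannHypothesis.Theses.DensityLadder.DensityBelowBourgain := by
  obtain ⟨σ₁, hσ₁, hσ₁', hwin⟩ := hLV
  refine ⟨σ₁, hσ₁', fun ε hε σ h₀ h₁ ↦ ?_⟩
  rcases le_or_gt σ (25 / 32) with h | h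
  · -- the window below Bourgain's abscissa: zero detection at `τ₀ = 3/2` from DH-strength large values
    exact hDet σ (by linarith) (by linarith) (hwin σ h₀ h) ε hε
  · -- the literature floor `[25/32, 1]`
    exact hFloor ε hε σ h.le h₁

/-- The crux along this line, MODULO exactly the three registered stubs (depends on `sorryAx` only
through `stub_largeValues_DHstrength_belowBourgain`, `stub_zeroDetection_threeHalves`,
`stub_bourgain_floor`). [folklore] -/
theorem DensityBelowBourgain_proof :
    Summit.RiemannHypothesis.RiemannHypothesis.Theses.DensityLadder.DensityBelowBourgain :=
  DensityBelowBourgain_of stub_largeValues_DHstrength_belowBourgain stub_zeroDetection_threeHalves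
    stub_bourgain_floor

/-! ## Calibration (sorry-free): Montgomery's conjecture implies the LV predicate

`LargeValuesDHStrength σ` is at most Montgomery-hard: the vetted Guth–Maynard form
`MontgomeryLargeValueConjecture` (regime `N ≤ T ≤ N^A`, `Ioc`-blocks in `exp` rendering, strict large
values) gives it for every `1/2 < σ ≤ 1`, after peeling the first term of the `Icc`-block and trading
`δ` for `δ/2`. This shows the stub LV is a WEAKENING of a standard conjecture restricted to a window,
not a disguised form of the crux. -/

/-- The block sum over `Icc N 2N` in the `cpow` rendering, minus its first term, is the block sum
over `Ioc N 2N` in the `exp` rendering of `MontgomeryLargeValueConjecture`. [folklore] -/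
theorem sum_Icc_cpow_eq (N : ℕ) (b : ℕ → ℂ) (t : ℝ) :
    ∑ n ∈ Finset.Icc N (2 * N), b n * (n : ℂ) ^ ((t : ℂ) * I) =
      b N * (N : ℂ) ^ ((t : ℂ) * I) +
        ∑ n ∈ Finset.Ioc N (2 * N), b n * Complex.exp (I * (t : ℂ) * (Real.log n : ℂ)) := by
  rw [← Finset.sum_Ioc_add_eq_sum_Icc (by omega : N ≤ 2 * N), add_comm]
  congr 1
  refine Finset.sum_congr rfl fun n hn ↦ ?_
  have hn0 : 0 < n := lt_of_le_of_lt (Nat.zero_le N) (Finset.mem_Ioc.mp hn).1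
  have hn0' : (n : ℂ) ≠ 0 := by exact_mod_cast hn0.ne'
  rw [Complex.cpow_def_of_ne_zero hn0', ← Complex.natCast_log]
  congr 1
  ring_nf

/-- `‖b N · N^{it}‖ ≤ 1` for `1`-bounded `b` and `N ≥ 1`. [folklore] -/
theorem norm_first_term_le {N : ℕ} (hN : 0 < N) {b : ℕ → ℂ} (hb : ∀ n, ‖b n‖ ≤ 1) (t : ℝ) :
    ‖b N * (N : ℂ) ^ ((t : ℂ) * I)‖ ≤ 1 := by
  rw [norm_mul, Complex.norm_natCast_cpow_of_pos hN]
  simp only [mul_re, ofReal_re, I_re, mul_zero, ofReal_im, I_im, mul_one, sub_self,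
    Real.rpow_zero, mul_one]
  exact hb N

/-- **LV is at most Montgomery-hard**: `MontgomeryLargeValueConjecture` (Guth–Maynard Conj. 1.5 form,
regime `N ≤ T ≤ N^A`) implies `LargeValuesDHStrength σ` for `1/2 < σ ≤ 1`. [folklore] -/
theorem largeValuesDHStrength_of_LVC (hLVC : MontgomeryLargeValueConjecture) {σ : ℝ}
    (hσ : 1 / 2 < σ) (hσ1 : σ ≤ 1) : LargeValuesDHStrength σ := by
  intro ε hε
  -- parameters
  set δ : ℝ := min (ε / 4) ((σ - 1 / 2) / 2) with hδdef
  have hδ0 : 0 < δ := lt_min (by linarith) (by linarith)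
  have hδε : 4 * δ ≤ ε := by linarith [min_le_left (ε / 4) ((σ - 1 / 2) / 2)]
  have hσδ : 1 / 2 < σ - δ := by linarith [min_le_right (ε / 4) ((σ - 1 / 2) / 2)]
  obtain ⟨C, hC⟩ := hLVC (σ - δ) hσδ (3 / 2) (by norm_num) (ε / 2) (by linarith)
  -- thresholds: `T ≥ T₀ := 3^{3/δ}` gives `N ≥ T^{2/3} ≥ 3^{2/δ}`, so `N^{δ/2} ≥ 3`
  refine ⟨δ / 2, max C 0, (3 : ℝ) ^ (3 / δ), by linarith, ?_⟩
  intro T hT N b W hNlo hNhi hb hW hsep hlarge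
  have h3pos : (0 : ℝ) < (3 : ℝ) ^ (3 / δ) := Real.rpow_pos_of_pos (by norm_num) _
  have h3one : (1 : ℝ) ≤ (3 : ℝ) ^ (3 / δ) := Real.one_le_rpow (by norm_num) (by positivity)
  have hT1 : 1 ≤ T := h3one.trans hT
  have hT0 : 0 < T := by linarith
  have hN1 : (1 : ℝ) ≤ N := le_trans (Real.one_le_rpow hT1 (by norm_num)) hNlo
  have hN0 : (0 : ℝ) < N := by linarith
  have hNpos : 0 < N := by exact_mod_cast hN0
  -- `N^{δ/2} ≥ 3`
  have hNδ : (3 : ℝ) ≤ (N : ℝ) ^ (δ / 2) := by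
    have h1 : (3 : ℝ) ^ (3 / δ) ≤ T := hT
    have h2 : T ^ (2 / 3 : ℝ) ≤ N := hNlo
    have h3 : ((3 : ℝ) ^ (3 / δ)) ^ (2 / 3 : ℝ) ≤ T ^ (2 / 3 : ℝ) :=
      Real.rpow_le_rpow h3pos.le h1 (by norm_num)
    have h4 : ((3 : ℝ) ^ (3 / δ)) ^ (2 / 3 : ℝ) = (3 : ℝ) ^ (2 / δ) := by
      rw [← Real.rpow_mul (by norm_num)]; congr 1; field_simp
    have h5 : (3 : ℝ) ^ (2 / δ) ≤ N := by rw [← h4]; exact h3.trans h2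
    have h6 : ((3 : ℝ) ^ (2 / δ)) ^ (δ / 2) ≤ (N : ℝ) ^ (δ / 2) :=
      Real.rpow_le_rpow (Real.rpow_nonneg (by norm_num) _) h5 (by linarith)
    have h7 : ((3 : ℝ) ^ (2 / δ)) ^ (δ / 2) = 3 := by
      rw [← Real.rpow_mul (by norm_num)]
      have : 2 / δ * (δ / 2) = 1 := by field_simp
      rw [this, Real.rpow_one]
    rw [← h7]; exact h6
  -- regime `T ≤ N^{3/2}`
  have hTN : T ≤ (N : ℝ) ^ (3 / 2 : ℝ) := by
    have h1 : (T ^ (2 / 3 : ℝ)) ^ (3 / 2 : ℝ) = T := by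
      rw [← Real.rpow_mul hT0.le]; norm_num
    rw [← h1]
    exact Real.rpow_le_rpow (Real.rpow_nonneg hT0.le _) hNlo (by norm_num)
  -- strict large values `> N^{σ-δ}` of the `Ioc`-block in `exp` form
  have hlarge' : ∀ t ∈ W, (N : ℝ) ^ (σ - δ) <
      ‖∑ n ∈ Finset.Ioc N (2 * N), b n * Complex.exp (I * (t : ℂ) * (Real.log n : ℂ))‖ := by
    intro t ht
    have h := hlarge t ht
    rw [sum_Icc_cpow_eq] at h
    have htri := norm_add_le (b N * (N : ℂ) ^ ((t : ℂ) * I))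
      (∑ n ∈ Finset.Ioc N (2 * N), b n * Complex.exp (I * (t : ℂ) * (Real.log n : ℂ)))
    have hfirst := norm_first_term_le hNpos hb t
    -- `N^{σ-δ/2} = N^{σ-δ} N^{δ/2} ≥ 3 N^{σ-δ} ≥ N^{σ-δ} + 2`, `N^{σ-δ} ≥ 1`
    have hpow : (N : ℝ) ^ (σ - δ / 2) = (N : ℝ) ^ (σ - δ) * (N : ℝ) ^ (δ / 2) := by
      rw [← Real.rpow_add hN0]; congr 1; ring
    have hone : (1 : ℝ) ≤ (N : ℝ) ^ (σ - δ) := Real.one_le_rpow hN1 (by linarith)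
    have hge : (N : ℝ) ^ (σ - δ) + 2 ≤ (N : ℝ) ^ (σ - δ / 2) := by
      rw [hpow]
      nlinarith [hNδ, hone]
    linarith
  -- apply the conjecture
  have hcount := hC N T b W hNhi hTN hb hW hsep hlarge'
  -- compare the bounds: `C T^{ε/2} N^{2-2(σ-δ)} ≤ max C 0 · T^{2(1-σ)+ε}`
  have hexp0 : 0 ≤ 2 - 2 * (σ - δ) := by linarith
  have hNT : (N : ℝ) ^ (2 - 2 * (σ - δ)) ≤ T ^ (2 - 2 * (σ - δ)) :=
    Real.rpow_le_rpow hN0.le hNhi hexp0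
  have hTT : T ^ (ε / 2) * T ^ (2 - 2 * (σ - δ)) ≤ T ^ (2 * (1 - σ) + ε) := by
    rw [← Real.rpow_add hT0]
    exact Real.rpow_le_rpow_of_exponent_le hT1 (by linarith)
  have hC0 : C ≤ max C 0 := le_max_left _ _
  have hM0 : 0 ≤ max C 0 := le_max_right _ _
  calc (W.card : ℝ) ≤ C * T ^ (ε / 2) * (N : ℝ) ^ (2 - 2 * (σ - δ)) := hcount
    _ ≤ max C 0 * T ^ (ε / 2) * (N : ℝ) ^ (2 - 2 * (σ - δ)) := by
        gcongr
    _ ≤ max C 0 * T ^ (ε / 2) * T ^ (2 - 2 * (σ - δ)) := by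
        gcongr
    _ = max C 0 * (T ^ (ε / 2) * T ^ (2 - 2 * (σ - δ))) := by ring
    _ ≤ max C 0 * T ^ (2 * (1 - σ) + ε) := by
        gcongr

/-!
## BC3 PROBE LOG (planner folder `bc/`, farm `lean check --json`, 2026-08-17)

Skeleton audit (this file): rc 0; sorries 3 = stubs 3 (`stub_largeValues_DHstrength_belowBourgain`,
`stub_zeroDetection_threeHalves`, `stub_bourgain_floor`), zero elsewhere; `DensityBelowBourgain_of`
is `proof.conditional` concluding `Summit.RiemannHypothesis.RiemannHypothesis.Theses.DensityLadder.DensityBelowBourgain`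
BY NAME; `largeValuesDHStrength_of_LVC`, `sum_Icc_cpow_eq`, `norm_first_term_le` sorry-free.

Per stub, files `bc/<stub>_probe.lean` (imports `Theses.DensityLadder`, `MontgomeryLargeValuesConjecture`,
`MontgomeryLargeValuesProofs`, `ZeroDensityGuthMaynardWindow`, `HarnessLib`; `abbrev Stub := <stub signature>`;
`set_option maxHeartbeats 400000`; ONE tactic per `example`):
* A: `example : Stub → DensityLadder.DensityBelowBourgain` by `exact?` / `simpa [Stub]` / `(unfold Stub; simpa)` / `aesop`
* B: `example : Stub → Summit.RiemannHypothesis` by the same four tactics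
* C: `example : Stub` by `first | exact? | simp [Stub] | aesop`

Results (each file rc 1, every example FAILS — as required):
* `stub_largeValues_DHstrength_belowBourgain`: A 4/4 fail (`exact?` "could not close the goal";
  `simpa`: "Tactic `assumption` failed"; `aesop`: "failed to prove the goal after exhaustive search",
  goal `a : Stub ⊢ DensityBelowBourgain`); B 4/4 fail (goal `⊢ Summit.RiemannHypothesis`); C fails.
* `stub_zeroDetection_threeHalves`: A 4/4 fail; B 4/4 fail; C fails (same messages).
* `stub_bourgain_floor`: A 4/4 fail; B 4/4 fail; C fails (same messages).

Verdict: no stub cheaply gives the crux or the summit, none is cheaply provable: bc3 PASS.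
-/

end Summit.RiemannHypothesis.RiemannHypothesis.Cruxes.DensityBelowBourgain.Birth

end
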